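import Literature.NumberTheory.EllipticCurves.GrossPointsExistenceGeneralLevel
import HarnessLib

/-!
# Towers of Gross points exist for an ARBITRARY level `N⁺` (Bertolini–Darmon 1996, Lemma 2.2 and §2.4,
# without the square-free hypothesis on `N⁺`)

Topic `NumberTheory/EllipticCurves`, sequel of `GrossPointsTowerExistence.lean` (square-free `N = N⁺N⁻`) and of
`GrossPointsExistenceGeneralLevel.lean` (local optimal embeddings at every prime for arbitrary `N⁺`).  THEOREMS ONLY
(no definition, no named fact, no `sorry`, no instance).

The tree's `nonempty_grossPointTower_of_heegner` (= the named fact `nonempty_grossPointTower`) carries the hypothesis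
`Squarefree (N⁺N⁻)`, used exactly once: for the local optimal embeddings of `f(𝓞_K)` at the primes `q ∣ N⁺`
(level-`q` Eichler model).  `GrossPointsExistenceGeneralLevel.exists_local_general` supplies those at every prime for an
ARBITRARY `N⁺` (Eichler level `q^{v_q(N⁺)}`, Hijikata §2); the rest of BD96's construction (§4 gluing, §5 the half-line
of the Bruhat–Tits tree at `p`, §6 the tower `J₀ ⊇ J₁ ⊇ ⋯`) is level-blind.  Hence:

* `nonempty_grossPointTower_of_heegner_general` — for a Brandt set-up `S` of type `(N⁺, N⁻)` (ANY `N⁺ ≥ 1`), `K`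
  imaginary quadratic, `(N⁺N⁻p, d_K) = 1`, `p ∤ N⁺N⁻`, primes of `N⁺` split and of `N⁻` inert in `K`, a
  `GrossPointTower K S p` exists (Heegner representatives `(f, J_n)` of conductor `pⁿ`, `n ≥ 0`, `p`-neighbours).

The assembly below is the tree's §6 verbatim with `exists_local` replaced by `exists_local_general`.

References: M. Bertolini, H. Darmon, Invent. Math. 126 (1996), Lemma 2.1–2.2, §2.4 [BertoliniDarmon1996];
M.-F. Vignéras, LNM 800, Ch. III §5 Thm. 5.11–Cor. 5.12 [VignerasLNM800]; H. Hijikata, J. Math. Soc. Japan 26 (1974) §2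
[Hijikata1974].
-/

noncomputable section

open scoped Pointwise Matrix
open NumberField Module IsDedekindDomain
open Literature.NumberTheory.QuadraticFields.Quadratic
open Literature.NumberTheory.Automorphic

universe u

namespace Literature.NumberTheory.EllipticCurves

namespace GrossPointsTowerGeneralLevel

open GrossPointTowerExistence

variable {K : Type u} [Field K] [NumberField K]

/-! ### Private plumbing (copies of the private helpers of `GrossPointsTowerExistence`) -/

section Plumbing

variable {D : Type*} [Ring D] [Algebra ℚ D]

omit [NumberField K] in
/-- `ω ∉ ℚ` for a `ℤ`-basis `(1, ω)` of `𝓞 K`. [folklore] -/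
private theorem ratCast_ne_basis_one [NumberField K] (b : Basis (Fin 2) ℤ (𝓞 K)) (hb : b 0 = 1) (q : ℚ) :
    (q : K) ≠ ((b 1 : 𝓞 K) : K) := by
  intro h
  have hd : (q.den : ℤ) ≠ 0 := by exact_mod_cast q.den_ne_zero
  have h1 : (q : K) * ((q.den : ℤ) : K) = ((q.num : ℤ) : K) := by
    have e := Rat.mul_den_eq_num q
    rw [Int.cast_natCast, ← Rat.cast_natCast, ← Rat.cast_mul, e, Rat.cast_intCast]
  have hK : ((q.den : ℤ) : K) * ((b 1 : 𝓞 K) : K) = ((q.num : ℤ) : K) := by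
    rw [← h, mul_comm]; exact h1
  have hO : (q.den : ℤ) • b 1 = (q.num : ℤ) • b 0 := by
    apply RingOfIntegers.ext
    rw [hb, zsmul_eq_mul, zsmul_eq_mul, mul_one]
    simp only [map_mul, map_intCast]
    exact hK
  have hli := b.linearIndependent
  rw [Fintype.linearIndependent_iff] at hli
  have h0 := hli ![-(q.num : ℤ), (q.den : ℤ)] (by
    rw [Fin.sum_univ_two]
    simp only [Matrix.cons_val_zero, Matrix.cons_val_one]
    rw [hO, neg_smul, neg_add_cancel]) 1
  simp only [Matrix.cons_val_one] at h0
  exact hd h0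

/-- `f(ω) ∉ ℚ`. [folklore] -/
private theorem algHom_basis_one_not_mem_bot [IsQuaternionAlgebra ℚ D]
    (b : Basis (Fin 2) ℤ (𝓞 K)) (hb : b 0 = 1) (f : K →ₐ[ℚ] D) :
    f ((b 1 : 𝓞 K) : K) ∉ (⊥ : Subalgebra ℚ D) := by
  haveI : Nontrivial D := Brandt.nontrivial_of_isQuaternionAlgebra
  rw [Algebra.mem_bot]
  rintro ⟨q, hq⟩
  apply ratCast_ne_basis_one b hb q
  apply f.toRingHom.injective
  change f (q : K) = f _
  rw [← hq]
  exact f.commutes q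

/-- Every element of the quadratic field is `u + v ω`. [folklore] -/
private theorem exists_rat_eq (h2 : finrank ℚ K = 2) (b : Basis (Fin 2) ℤ (𝓞 K)) (hb : b 0 = 1) (x : K) :
    ∃ u v : ℚ, x = (u : K) + (v : K) * ((b 1 : 𝓞 K) : K) :=
  Literature.NumberTheory.QuadraticFields.QuadraticOrderLattice.exists_rat_add_rat_mul h2
    (ratCast_ne_basis_one b hb) x

/-- `f(u + v ω) = u + v f(ω)`. [folklore] -/
private theorem algHom_ratCoords (f : K →ₐ[ℚ] D) (ω : K) (u v : ℚ) :
    f ((u : K) + (v : K) * ω) = algebraMap ℚ D u + v • f ω := by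
  rw [map_add, map_mul, show (u : K) = algebraMap ℚ K u from rfl, show (v : K) = algebraMap ℚ K v from rfl,
    f.commutes, f.commutes, Algebra.smul_def]

omit [NumberField K] in
/-- `ω² = m + tω` in `K`. [folklore] -/
private theorem basis_one_mul_self_eq_cast [NumberField K] (b : Basis (Fin 2) ℤ (𝓞 K)) (hb : b 0 = 1) :
    ((b 1 : 𝓞 K) : K) * ((b 1 : 𝓞 K) : K) =
      ((b.repr (b 1 * b 1) 0 : ℤ) : K) + ((b.repr (b 1 * b 1) 1 : ℤ) : K) * ((b 1 : 𝓞 K) : K) := by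
  have h := congrArg (fun z : 𝓞 K => (z : K)) (basis_one_mul_self_eq b hb)
  simpa using h

/-- `f(ω)² = t f(ω) − (−m)` in the `algebraMap`/`•` form. [folklore] -/
private theorem algHom_basis_one_mul_self (b : Basis (Fin 2) ℤ (𝓞 K)) (hb : b 0 = 1) (f : K →ₐ[ℚ] D) :
    f ((b 1 : 𝓞 K) : K) * f ((b 1 : 𝓞 K) : K) =
      ((b.repr (b 1 * b 1) 1 : ℤ) : ℚ) • f ((b 1 : 𝓞 K) : K) -
        algebraMap ℚ D ((-(b.repr (b 1 * b 1) 0) : ℤ) : ℚ) := by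
  set t : ℤ := b.repr (b 1 * b 1) 1 with htdef
  set m : ℤ := b.repr (b 1 * b 1) 0 with hmdef
  have h : ((b 1 : 𝓞 K) : K) * ((b 1 : 𝓞 K) : K) = ((m : ℤ) : K) + ((t : ℤ) : K) * ((b 1 : 𝓞 K) : K) :=
    basis_one_mul_self_eq_cast b hb
  have hf : f (((b 1 : 𝓞 K) : K) * ((b 1 : 𝓞 K) : K)) = (m : D) + (t : D) * f ((b 1 : 𝓞 K) : K) := by
    rw [h, map_add, map_mul (f := f), map_intCast, map_intCast]
  rw [← map_mul (f := f), hf, Algebra.smul_def, ← map_intCast (algebraMap ℚ D) m, ← map_intCast (algebraMap ℚ D) t,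
    Int.cast_neg, map_neg, sub_neg_eq_add, add_comm]

/-- `trd f(ω) = t`, `nrd f(ω) = −m`. [folklore] -/
private theorem reducedTrace_and_reducedNorm_algHom_basis_one [IsQuaternionAlgebra ℚ D]
    (b : Basis (Fin 2) ℤ (𝓞 K)) (hb : b 0 = 1) (f : K →ₐ[ℚ] D) :
    reducedTrace ℚ D (f ((b 1 : 𝓞 K) : K)) = ((b.repr (b 1 * b 1) 1 : ℤ) : ℚ) ∧
      reducedNorm ℚ D (f ((b 1 : 𝓞 K) : K)) = ((-(b.repr (b 1 * b 1) 0) : ℤ) : ℚ) := by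
  set γ := f ((b 1 : 𝓞 K) : K) with hγdef
  have h1 := mul_self_eq_reducedTrace_mul_sub_reducedNorm ℚ D γ
  rw [algHom_basis_one_mul_self b hb f] at h1
  have e : algebraMap ℚ D (-(((-(b.repr (b 1 * b 1) 0) : ℤ)) : ℚ)) +
      ((b.repr (b 1 * b 1) 1 : ℤ) : ℚ) • γ =
      algebraMap ℚ D (-reducedNorm ℚ D γ) + reducedTrace ℚ D γ • γ := by
    rw [map_neg, map_neg, neg_add_eq_sub, neg_add_eq_sub, Algebra.smul_def (reducedTrace ℚ D γ)]
    exact h1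
  obtain ⟨hn, ht⟩ := Brandt.rat_coords_unique (algHom_basis_one_not_mem_bot b hb f) e
  exact ⟨ht.symm, (neg_injective hn).symm⟩

/-- Membership in `f(𝒪_{pⁿ})`: basis `(1, pⁿ f(ω))`. [folklore] -/
private theorem mem_ordLat_pow_iff (b : Basis (Fin 2) ℤ (𝓞 K)) (hb : b 0 = 1) (f : K →ₐ[ℚ] D) (p n : ℕ) (y : D) :
    y ∈ ordLat f (p ^ n) ↔ ∃ u v : ℤ, y = algebraMap ℚ D u + v • (((p : ℚ) ^ n) • f ((b 1 : 𝓞 K) : K)) := by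
  rw [mem_ordLat_iff b hb f (p ^ n), Nat.cast_pow]

/-- `f(𝒪_d) ⊆ f(𝒪_c)` for `c ∣ d`. [folklore] -/
private theorem ordLat_mono (f : K →ₐ[ℚ] D) {c d : ℕ} (h : c ∣ d) : ordLat f d ≤ ordLat f c :=
  Submodule.map_mono fun _ hx => quadOrder_le_of_dvd h hx

/-- `d · f(𝓞_K) ⊆ f(𝒪_d)`. [folklore] -/
private theorem natCast_smul_mem_ordLat (b : Basis (Fin 2) ℤ (𝓞 K)) (hb : b 0 = 1) (f : K →ₐ[ℚ] D)
    (d : ℕ) {y : D} (hy : y ∈ ordLat f 1) : ((d : ℤ)) • y ∈ ordLat f d := by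
  obtain ⟨u, v, rfl⟩ := (mem_ordLat_iff b hb f 1 y).mp hy
  refine (mem_ordLat_iff b hb f d _).mpr ⟨d * u, v, ?_⟩
  rw [smul_add, Nat.cast_one, one_smul, smul_comm, ← Int.cast_smul_eq_zsmul ℚ (d : ℤ),
    ← Int.cast_smul_eq_zsmul ℚ (d : ℤ), Algebra.smul_def, ← map_mul]
  push_cast
  rfl

/-- `f(𝒪_{pⁿ})_(q) = f(𝓞_K)_(q)` for `q ≠ p`. [folklore] -/
private theorem localAt_ordLat_pow_eq [IsAddTorsionFree D] (b : Basis (Fin 2) ℤ (𝓞 K)) (hb : b 0 = 1) (f : K →ₐ[ℚ] D)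
    {p : ℕ} (hp : p.Prime) (n : ℕ) {q : ℕ} (hq : q.Prime) (hqp : q ≠ p) :
    localAt q (ordLat f (p ^ n)) = localAt q (ordLat f 1) := by
  refine localAt_eq_of_smul_le_of_smul_le (m := p ^ n) (m' := 1) (pow_ne_zero _ hp.ne_zero)
    one_ne_zero (fun x hx => ?_) (fun x hx => ?_)
    (Nat.Coprime.pow_left n ((Nat.coprime_primes hp hq).mpr (Ne.symm hqp))) (Nat.coprime_one_left q)
  · have h := natCast_smul_mem_ordLat b hb f (p ^ n) hx
    rwa [Nat.cast_pow] at h ⊢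
  · rw [Nat.cast_one, one_smul]; exact ordLat_mono f (one_dvd _) hx

end Plumbing

/-! ### Towers at arbitrary level -/

section Assembly

open Literature.NumberTheory.QuadraticFields.PadicQuadratic

variable {Nplus Nminus : ℕ} (S : Brandt.XiSetup Nplus Nminus) (p : ℕ) [hp : Fact p.Prime]

/-- The algebra of a Brandt set-up is a division algebra. [folklore] -/
private theorem isUnit_of_ne_zero_setup : ∀ x : S.D, x ≠ 0 → IsUnit x := fun _ hx =>
  isUnit_of_isTotallyDefinite S.D S.isTotallyDefinite hx

omit hp in
/-- `p • X = ν • X` for the central unit `ν = p · 1`. [folklore] -/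
private theorem natCast_smul_eq_units_smul {ν : S.Dˣ} {n : ℕ} (hν : (ν : S.D) = (n : ℤ))
    (X : Submodule ℤ S.D) : ((n : ℤ)) • X = ν • X := by
  ext x
  rw [Units.smul_def, Submodule.mem_smul_pointwise_iff_exists, Submodule.mem_smul_pointwise_iff_exists]
  constructor
  · rintro ⟨y, hy, rfl⟩; exact ⟨y, hy, by rw [hν, smul_eq_mul, zsmul_eq_mul]⟩
  · rintro ⟨y, hy, rfl⟩; exact ⟨y, hy, by rw [hν, smul_eq_mul, zsmul_eq_mul]⟩

omit hp in
/-- `det g_n ≠ 0` for the tower matrices built on a cyclic vector (`det g_n = pⁿ det(v₀, A v₀)`). [folklore] -/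
private theorem isUnit_det_towerMat [Fact p.Prime] (Φ : S.D →ₐ[ℚ] Matrix (Fin 2) (Fin 2) ℚ_[p]) {γ : S.D}
    {v₀ : Fin 2 → ℚ_[p]} (hv₀ : Brandt.vdet v₀ (Φ γ *ᵥ v₀) ≠ 0) (n : ℕ) :
    IsUnit (towerMat Φ γ v₀ n).det := by
  have h : (towerMat Φ γ v₀ n).det = (p : ℚ_[p]) ^ n * Brandt.vdet v₀ (Φ γ *ᵥ v₀) := by
    rw [towerMat, Brandt.det_eq_vdet_col, Brandt.ofCols_col_zero, Brandt.ofCols_col_one, Brandt.vdet_iota]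
    simp [QuadraticAlgebra.re_one, QuadraticAlgebra.im_one]
  rw [h, isUnit_iff_ne_zero]
  exact mul_ne_zero (pow_ne_zero _ (Nat.cast_ne_zero.mpr (Fact.out : p.Prime).ne_zero)) hv₀

/-- **Towers of Gross points exist for an ARBITRARY level `N⁺`** (BD96 Lemma 2.2 with §2.4, definite case, `c = 1`, the
square-free hypothesis on `N⁺` REMOVED): under the definite Heegner hypothesis — `K` imaginary quadratic, `(N⁺N⁻p, d_K) = 1`,
`p ∤ N⁺N⁻`, primes of `N⁺` split, primes of `N⁻` inert — there are Heegner representatives `(f, J_n)` of conductor `pⁿ`,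
`n ≥ 0`, with `p J_n ⊆ J_{n+1} ⊆ J_n`, `[J_{n+1} : p J_n] = p²`, i.e. a `GrossPointTower K S p`.  Proof: `K ↪ D`
(`nonempty_algHom`); local optimal embeddings of `𝓞_K` at EVERY prime for arbitrary `N⁺`
(`GrossPointsGeneralLevel.exists_local_general`, Eichler level `q^{v_q(N⁺)}`); gluing (`exists_invertible_optimalOrder_eq`);
the half-line of the Bruhat–Tits tree at `p` (`TowerHyp`, tree §5). [cite: BertoliniDarmon1996, Lemma 2.2 and §2.4]
[cite: VignerasLNM800, Ch. III §5 Thm. 5.11, Cor. 5.12] [cite: Hijikata1974, §2] -/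
theorem nonempty_grossPointTower_of_heegner_general (hK : IsImaginaryQuadratic K)
    (hcop : (Nplus * Nminus * p).Coprime (NumberField.discr K).natAbs) (hpN : ¬ p ∣ Nplus * Nminus)
    (hsplit : ∀ ℓ : ℕ, ℓ.Prime → ℓ ∣ Nplus → ((Ideal.span {(ℓ : ℤ)}).primesOver (𝓞 K)).ncard = 2)
    (hinert : ∀ ℓ : ℕ, ℓ.Prime → ℓ ∣ Nminus → ((Ideal.span {(ℓ : ℤ)}).primesOver (𝓞 K)).ncard = 1) :
    Nonempty (GrossPointTower K S p) := by
  classical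
  haveI : Nontrivial S.D := Brandt.nontrivial_of_isQuaternionAlgebra
  haveI : IsAddTorsionFree S.D := S.isAddTorsionFree
  obtain ⟨b, hb⟩ := exists_basis_zero_eq_one hK.1
  have hcopN : (Nplus * Nminus).Coprime (NumberField.discr K).natAbs := hcop.of_dvd_left (dvd_mul_right _ _)
  have hcopm : ∀ ℓ : ℕ, ℓ.Prime → ℓ ∣ Nminus → ¬ (ℓ : ℤ) ∣ NumberField.discr K := fun ℓ hℓ hℓN h => by
    have h' : ℓ ∣ (NumberField.discr K).natAbs := Int.natCast_dvd_natCast.mp (Int.dvd_natAbs.mpr h)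
    exact hℓ.one_lt.ne'
      (Nat.Coprime.eq_one_of_dvd (hcopN.of_dvd_left (hℓN.trans (dvd_mul_left Nminus Nplus))) h')
  obtain ⟨f⟩ := nonempty_algHom S hK hcopm hinert
  set ω : K := ((b 1 : 𝓞 K) : K) with hωdef
  set γ : S.D := f ω with hγdef
  have hD := isUnit_of_ne_zero_setup S
  have hO := S.isEichlerOrder.isOrder
  have hOZ : IsZOrder S.O := S.toEichlerPackage.isEichlerOrder.isZOrder
  have hγ : γ ∉ (⊥ : Subalgebra ℚ S.D) := algHom_basis_one_not_mem_bot b hb f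
  have hB : Brandt.IsQuadOrder γ (ordLat f 1) := isQuadOrder_ordLat_one hK.1 b hb f
  -- local optimal embeddings at EVERY prime, arbitrary `N⁺` (g33 `GrossPointsExistenceGeneralLevel`)
  have hloc := GrossPointsGeneralLevel.exists_local_general S hK.1 b hb f hcopN hsplit
  -- the matrix model at `p`, a cyclic vector, the base vertex
  obtain ⟨Φ, hΦ⟩ := S.exists_localAt_iff_integral S.nplus_ne_zero hpN
  obtain ⟨v₀, hv₀⟩ := Brandt.exists_vdet_mulVec_ne_zero (Brandt.map_ne_smul_one Φ hD hγ)
  obtain ⟨w₀, hw₀⟩ := Brandt.exists_units_colLatt_eq Φ hD _ (isUnit_det_towerMat S p Φ (γ := γ) hv₀ 0)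
  obtain ⟨htrγ, hnrγ⟩ := reducedTrace_and_reducedNorm_algHom_basis_one b hb f
  have htr : ‖((reducedTrace ℚ S.D γ : ℚ) : ℚ_[p])‖ ≤ 1 := by
    rw [hγdef, hωdef, htrγ, Rat.cast_intCast]; exact Padic.norm_int_le_one _
  have hnr : ‖((reducedNorm ℚ S.D γ : ℚ) : ℚ_[p])‖ ≤ 1 := by
    rw [hγdef, hωdef, hnrγ, Rat.cast_intCast]; exact Padic.norm_int_le_one _
  have hBσ : ∀ (n : ℕ) (y : S.D), y ∈ ordLat f (p ^ n) ↔
      ∃ u v : ℤ, y = algebraMap ℚ S.D u + v • (((p : ℚ) ^ n) • γ) := mem_ordLat_pow_iff b hb f p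
  have hopt_loc : ∀ (n : ℕ) (w : S.Dˣ), Brandt.colLatt (Φ (w : S.D)) = Brandt.colLatt (towerMat Φ γ v₀ n) →
      Brandt.optimalOrder (w • localAt p S.O) γ = localAt p (ordLat f (p ^ n)) := fun n w hw =>
    optimalOrder_smul_eq_of_towerMat Φ hD hγ hΦ hO.one_mem hO.mul_mem hv₀ htr hnr n w hw (hBσ n)
  have hw₀opt : Brandt.optimalOrder (w₀ • localAt p S.O) γ = localAt p (ordLat f 1) := by
    have h := hopt_loc 0 w₀ hw₀; rwa [pow_zero] at h
  obtain ⟨J₀, hJ₀inv, hJ₀B, hJ₀p⟩ := exists_invertible_optimalOrder_eq hO hB hloc hp.out w₀ hw₀opt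
  have H : TowerHyp Φ S.O γ v₀ w₀ J₀ := ⟨hD, hΦ, hOZ, hv₀, hw₀, hJ₀inv, hJ₀p⟩
  -- the optimal orders of the `J_n`
  have hopt : ∀ n : ℕ, Brandt.optimalOrder (H.ideal n).1 γ = ordLat f (p ^ n) := fun n => by
    refine eq_iff_forall_prime_localAt_eq.mpr fun q hq => ?_
    rw [← Brandt.optimalOrder_localAt q (H.ideal n).2.1.isFullLattice.1]
    by_cases hqp : q = p
    · subst hqp
      rw [(H.ideal n).2.2.1]
      exact hopt_loc n _ (H.gen n).2
    · rw [(H.ideal n).2.2.2 q hq hqp, Brandt.optimalOrder_localAt q hJ₀inv.isFullLattice.1, hJ₀B,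
        localAt_ordLat_pow_eq b hb f hp.out n hq hqp]
  -- Heegner representatives of conductor `pⁿ`
  have hHeeg : ∀ n : ℕ, (⟨f, (H.ideal n).1⟩ : GrossRep S.D K).IsHeegner S.O (p ^ n) := fun n => by
    refine ⟨mem_rightIdeals_of_isInvertibleRightIdeal hD hOZ (H.ideal n).2.1, fun x => ?_⟩
    change f x ∈ Brandt.leftOrder (H.ideal n).1 ↔ _
    constructor
    · intro hx
      obtain ⟨u, v, rfl⟩ := exists_rat_eq hK.1 b hb x
      have hadj : f ((u : K) + (v : K) * ω) ∈ Algebra.adjoin ℚ {γ} := by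
        rw [algHom_ratCoords]; exact Brandt.ratCoords_mem_adjoin γ u v
      have hmem : f ((u : K) + (v : K) * ω) ∈ Brandt.optimalOrder (H.ideal n).1 γ :=
        Brandt.mem_optimalOrder_iff.mpr ⟨hx, hadj⟩
      rw [hopt n] at hmem
      obtain ⟨a, ha, hfa⟩ := GrossRep.mem_embLattice_iff.mp hmem
      rw [← f.toRingHom.injective hfa]
      exact ha
    · intro hx
      have hmem : f x ∈ ordLat f (p ^ n) := GrossRep.apply_mem_embLattice f hx
      rw [← hopt n] at hmem
      exact Brandt.optimalOrder_le_leftOrder _ _ hmem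
  -- the central unit `p`
  obtain ⟨ν, hν, -⟩ := Brandt.exists_units_val_eq_natCast (D := S.D) hp.out.ne_zero
  have hνsmul : ∀ n : ℕ, (⟨f, ((p : ℤ)) • (H.ideal n).1⟩ : GrossRep S.D K) = ν • ⟨f, (H.ideal n).1⟩ := by
    intro n
    refine GrossRep.ext ?_ ?_
    · ext x
      change f x = (ν : S.D) * f x * ((ν⁻¹ : S.Dˣ) : S.D)
      rw [hν, (Int.cast_commute (p : ℤ) (f x)).eq, ← hν, mul_assoc, Units.mul_inv, mul_one]
    · exact natCast_smul_eq_units_smul S hν _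
  refine ⟨{ pt := fun n => GrossSpace.mk ⟨f, (H.ideal n).1⟩
            mem_grossPoints := fun n => mk_mem_grossPoints_iff.mpr (hHeeg n)
            isPNeighbour := fun n => ⟨f, (H.ideal (n + 1)).1, ((p : ℤ)) • (H.ideal n).1, rfl, ?_, ?_,
              H.relIndex_smul_ideal n⟩ }⟩
  · rw [hνsmul, GrossSpace.mk_units_smul]
  · intro x hx
    obtain ⟨y, hy, rfl⟩ := (Submodule.mem_smul_pointwise_iff_exists _ _ _).mp hx
    exact H.smul_mem_ideal_succ n hy

end Assembly

end GrossPointsTowerGeneralLevel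

end Literature.NumberTheory.EllipticCurves

end
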